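import Literature.MathematicalPhysics.StatisticalMechanics.HardDiscVirialProofs
import Literature.MathematicalPhysics.StatisticalMechanics.HardSphereVirialCoefficients
import Mathlib.Analysis.Real.Pi.Bounds
import HarnessLib

/-!
# The ring and diagonal-square Mayer diagrams of hard discs: exact volumes

Towards the discharge of the named fact
`Literature.MathematicalPhysics.StatisticalMechanics.HardSphereVirial.hardDisc_B4`
(`B₄/B₂³ = 2 − 9√3/(2π) + 10/π²`, [ClisbyMccoy2004, §1], citing Rowlinson 1964 and Hemmer 1964)
we prove the two "lens–convolution" values entering the Mayer expansion
`B₄ = −(1/8)(3·V(C₄) − 6·V(◇) + V(K₄))`: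

* `volume_ringDisc_toReal`    : `V(C₄) = vol(ringDisc)    = π³ − 16π/3`,
* `volume_diamondDisc_toReal` : `V(◇)  = vol(diamondDisc) = π³ − √3π² − 5π/6`.

## Proof (classical, cf. the tables of [ClisbyMccoy2004], [Lyberg2005])

Write a configuration as `(x₂, x₃, x₄) ∈ (ℝ²)³` (particle `1` at `0`). For the ring `1–2–3–4–1` the
conditions are `|x₂| < 1`, `|x₂ − x₃| < 1`, `|x₃ − x₄| < 1`, `|x₄| < 1`; for fixed `x₃ = p` the slice is
`lens(p) × lens(p)` with `lens(p) = B(0,1) ∩ B(p,1)`, of area `A(|p|)`,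
`A(r) = 2 arccos(r/2) − r√(1 − r²/4)` (`r < 2`; empty for `r ≥ 2`). Hence (Tonelli, then polar
coordinates) `V(C₄) = ∫_{|p|<2} A(|p|)² dp = 2π ∫₀² r A(r)² dr`, and for the diagonal square (extra chord
`1–3`, i.e. `|x₃| < 1`) `V(◇) = 2π ∫₀¹ r A(r)² dr`. With the explicit antiderivative
`F(r) = 2(r²−1) arccos²(r/2) − r(r²+2) arccos(r/2) √(1−r²/4) − r²/2 + r⁴/8 − r⁶/24` of `r A(r)²`
(substituting `r = 2cos(u/2)` turns `r A(r)²` into `−(u − sin u)² sin u`), `F(0) = −π²/2`,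
`F(1) = −√3π/2 − 5/12`, `F(2) = −8/3`, so `∫₀² rA² = π²/2 − 8/3` and `∫₀¹ rA² = π²/2 − √3π/2 − 5/12`.

All auxiliary results are [folklore] calculus / measure theory and live in the sub-namespace
`HardDiscRingVolume`; the lens-area and coordinate lemmas of `HardDiscTriangleVolume`
(`HardDiscVirialProofs.lean`) are reused. No definitions, no named facts.

## References

* [ClisbyMccoy2004] N. Clisby, B. M. McCoy, *Analytic calculation of B₄ for hard spheres in even
  dimensions*, J. Stat. Phys. 114 (2004) 1343–1361, §1 (Mayer expansion of `B₄`; `D = 2` value).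
-/

noncomputable section

open _root_.MeasureTheory _root_.Set _root_.Real intervalIntegral

namespace Literature.MathematicalPhysics.StatisticalMechanics

namespace HardDiscRingVolume

open HardDiscTriangleVolume

/-! ### The lens area for all distances `0 ≤ ρ < 2`, and the empty lens for `ρ ≥ 2` -/

/-- Lens area at distance `ρ ∈ [0, 2)`: `vol(B(0,1) ∩ B((0,ρ),1)) = A(ρ)` and `A(ρ) ≥ 0`
(same proof as `HardDiscTriangleVolume.volume_lens`, which is stated for `ρ ≤ 1`). [folklore] -/
theorem volume_lens_lt_two {ρ : ℝ} (h0 : 0 ≤ ρ) (h1 : ρ < 2) :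
    volume {q : ℝ × ℝ | q.1 ^ 2 + q.2 ^ 2 < 1 ∧ q.1 ^ 2 + (q.2 - ρ) ^ 2 < 1} =
      ENNReal.ofReal (2 * arccos (ρ / 2) - ρ * √(1 - ρ ^ 2 / 4)) ∧
      0 ≤ 2 * arccos (ρ / 2) - ρ * √(1 - ρ ^ 2 / 4) := by
  set c := √(1 - ρ ^ 2 / 4) with hc
  have hc4 : 0 < 1 - ρ ^ 2 / 4 := by nlinarith
  have hc0 : 0 < c := sqrt_pos.mpr hc4
  have hc1 : c ≤ 1 := by rw [hc, sqrt_le_one]; nlinarith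
  have hcsq : c ^ 2 = 1 - ρ ^ 2 / 4 := sq_sqrt hc4.le
  have hfg : ∀ x ∈ Ioo (-c) c, ρ - √(1 - x ^ 2) ≤ √(1 - x ^ 2) := by
    intro x hx
    have hq : x ^ 2 < 1 - ρ ^ 2 / 4 := Real.sq_lt.mpr hx
    have : ρ / 2 ≤ √(1 - x ^ 2) := by
      rw [Real.le_sqrt (by linarith) (by nlinarith)]; nlinarith
    linarith
  have f_int : IntegrableOn (fun x => ρ - √(1 - x ^ 2)) (Ioo (-c) c) volume :=
    (Continuous.integrableOn_Icc (by fun_prop)).mono_set Ioo_subset_Icc_self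
  have g_int : IntegrableOn (fun x => √(1 - x ^ 2)) (Ioo (-c) c) volume :=
    (Continuous.integrableOn_Icc (by fun_prop)).mono_set Ioo_subset_Icc_self
  have hI : ∫ x in Ioo (-c) c, ((fun x => √(1 - x ^ 2)) - fun x => ρ - √(1 - x ^ 2)) x
      = 2 * arccos (ρ / 2) - ρ * c := by
    have : ∫ x in Ioo (-c) c, ((fun x => √(1 - x ^ 2)) - fun x => ρ - √(1 - x ^ 2)) x
        = ∫ x in -c..c, (2 * √(1 - x ^ 2) - ρ) := by
      rw [intervalIntegral.integral_of_le (by linarith), integral_Ioc_eq_integral_Ioo]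
      congr 1; funext x; simp only [Pi.sub_apply]; ring
    rw [this, integral_lens_section hc0.le hc1]
    have h2 : √(1 - c ^ 2) = ρ / 2 := by
      rw [hcsq, show 1 - (1 - ρ ^ 2 / 4) = (ρ / 2) ^ 2 by ring, sqrt_sq (by linarith)]
    have h3 : arccos (ρ / 2) = arcsin c := by
      rw [arccos_eq_arcsin (by linarith), hc]; congr 2; ring
    rw [h2, h3]
    ring
  constructor
  · rw [lens_eq_regionBetween h0, Measure.volume_eq_prod,
      volume_regionBetween_eq_integral f_int g_int measurableSet_Ioo hfg, hI]
  · rw [← hI]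
    exact setIntegral_nonneg measurableSet_Ioo
      (fun x hx => by simp only [Pi.sub_apply]; linarith [hfg x hx])

/-- For `ρ ≥ 2` the standard lens is empty. [folklore] -/
theorem lens_eq_empty_of_two_le {ρ : ℝ} (h : 2 ≤ ρ) :
    {q : ℝ × ℝ | q.1 ^ 2 + q.2 ^ 2 < 1 ∧ q.1 ^ 2 + (q.2 - ρ) ^ 2 < 1} = ∅ := by
  ext q
  simp only [mem_setOf_eq, mem_empty_iff_false, iff_false, not_and]
  intro hA hB
  have h2 : q.2 ^ 2 < 1 := by nlinarith [sq_nonneg q.1]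
  have h3 : (q.2 - ρ) ^ 2 < 1 := by nlinarith [sq_nonneg q.1]
  have h2' := abs_lt.mp ((sq_lt_one_iff_abs_lt_one q.2).mp h2)
  have h3' := abs_lt.mp ((sq_lt_one_iff_abs_lt_one (q.2 - ρ)).mp h3)
  linarith [h2'.2, h3'.1]

/-- Volume of the lens of unit discs centred at `0` and at `p`: `A(|p|)` if `|p| < 2`, else `0`;
as an `ℝ≥0∞`-valued `if`. [folklore] -/
theorem volume_lensAt_eq_ite (p : ℝ × ℝ) :
    volume {q : ℝ × ℝ | q.1 ^ 2 + q.2 ^ 2 < 1 ∧ (p.1 - q.1) ^ 2 + (p.2 - q.2) ^ 2 < 1} =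
      if p.1 ^ 2 + p.2 ^ 2 < 4 then ENNReal.ofReal (2 * arccos (√(p.1 ^ 2 + p.2 ^ 2) / 2) -
        √(p.1 ^ 2 + p.2 ^ 2) * √(1 - √(p.1 ^ 2 + p.2 ^ 2) ^ 2 / 4)) else 0 := by
  rw [volume_lensAt]
  have hρ0 : 0 ≤ √(p.1 ^ 2 + p.2 ^ 2) := sqrt_nonneg _
  split_ifs with hp
  · have hρ2 : √(p.1 ^ 2 + p.2 ^ 2) < 2 := by
      rw [show (2:ℝ) = √4 by rw [show (4:ℝ) = 2 ^ 2 by norm_num, sqrt_sq (by norm_num)]]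
      exact sqrt_lt_sqrt (by positivity) hp
    exact (volume_lens_lt_two hρ0 hρ2).1
  · have hρ2 : 2 ≤ √(p.1 ^ 2 + p.2 ^ 2) := by
      rw [show (2:ℝ) = √4 by rw [show (4:ℝ) = 2 ^ 2 by norm_num, sqrt_sq (by norm_num)]]
      exact sqrt_le_sqrt (not_lt.mp hp)
    rw [lens_eq_empty_of_two_le hρ2, measure_empty]

/-! ### One-variable calculus: `∫ r A(r)² dr` -/

/-- `d/dr F(r) = r · A(r)²` on `(−2, 2)` for the explicit antiderivative
`F(r) = 2(r²−1) arccos²(r/2) − r(r²+2) arccos(r/2) √(1−r²/4) − r²/2 + r⁴/8 − r⁶/24`. [folklore] -/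
theorem hasDerivAt_sqLensAreaPrim {r : ℝ} (h1 : -2 < r) (h2 : r < 2) :
    HasDerivAt (fun r : ℝ => 2 * (r ^ 2 - 1) * arccos (r / 2) ^ 2
        - r * (r ^ 2 + 2) * arccos (r / 2) * √(1 - r ^ 2 / 4) - r ^ 2 / 2 + r ^ 4 / 8 - r ^ 6 / 24)
      (r * (2 * arccos (r / 2) - r * √(1 - r ^ 2 / 4)) ^ 2) r := by
  have hw : 0 < 1 - r ^ 2 / 4 := by nlinarith
  set w := √(1 - r ^ 2 / 4) with hw_def
  have hw0' : w ≠ 0 := (sqrt_pos.mpr hw).ne'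
  have hwsq : w ^ 2 = 1 - r ^ 2 / 4 := sq_sqrt hw.le
  have hr1 : r / 2 ≠ -1 := by intro h; linarith
  have hr2 : r / 2 ≠ 1 := by intro h; linarith
  have hd : HasDerivAt (fun x : ℝ => x / 2) (1 / 2) r := (hasDerivAt_id' r).div_const 2
  have hacos : HasDerivAt (fun x => arccos (x / 2)) (-(1 / √(1 - (r / 2) ^ 2)) * (1 / 2)) r := by
    have h := (hasDerivAt_arccos hr1 hr2).comp r hd
    exact h
  have hsq' : √(1 - (r / 2) ^ 2) = w := by rw [hw_def]; congr 1; ring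
  rw [hsq'] at hacos
  have hin : HasDerivAt (fun x : ℝ => 1 - x ^ 2 / 4) (-(2 * r / 4)) r := by
    simpa using ((hasDerivAt_pow 2 r).div_const 4).const_sub 1
  have hsqrt : HasDerivAt (fun x => √(1 - x ^ 2 / 4)) ((-(2 * r / 4)) / (2 * w)) r := by
    have := hin.sqrt hw.ne'
    rw [← hw_def] at this
    exact this
  -- the three summands
  have hA : HasDerivAt (fun x : ℝ => 2 * (x ^ 2 - 1)) (2 * (2 * r)) r := by
    simpa using ((hasDerivAt_pow 2 r).sub_const 1).const_mul 2
  have hB : HasDerivAt (fun x : ℝ => x * (x ^ 2 + 2)) (3 * r ^ 2 + 2) r := by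
    have := (hasDerivAt_id' r).fun_mul ((hasDerivAt_pow 2 r).add_const 2)
    refine this.congr_deriv ?_
    norm_num; ring
  have hP : HasDerivAt (fun x : ℝ => - x ^ 2 / 2 + x ^ 4 / 8 - x ^ 6 / 24)
      (-(2 * r) / 2 + 4 * r ^ 3 / 8 - 6 * r ^ 5 / 24) r := by
    have h2 := (hasDerivAt_pow 2 r)
    have h4 := (hasDerivAt_pow 4 r)
    have h6 := (hasDerivAt_pow 6 r)
    have := ((h2.fun_neg.div_const 2).fun_add (h4.div_const 8)).fun_sub (h6.div_const 24)
    refine this.congr_deriv ?_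
    norm_num
  have key := ((hA.fun_mul (hacos.fun_pow 2)).fun_sub ((hB.fun_mul hacos).fun_mul hsqrt)).fun_add hP
  rw [← hw_def] at key
  refine HasDerivAt.congr_deriv (key.congr_of_eventuallyEq ?_) ?_
  · filter_upwards with x
    ring
  · set a := arccos (r / 2)
    push_cast
    field_simp
    linear_combination (a * (1536 * r ^ 2 - 3072) - 1536 * r ^ 3 * w) * hwsq

/-- `∫₀² r A(r)² dr = π²/2 − 8/3`. [folklore] -/
theorem integral_mul_sqLensArea_two :
    ∫ r in (0:ℝ)..2, r * (2 * arccos (r / 2) - r * √(1 - r ^ 2 / 4)) ^ 2 = π ^ 2 / 2 - 8 / 3 := by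
  have hcont : ContinuousOn (fun r : ℝ => 2 * (r ^ 2 - 1) * arccos (r / 2) ^ 2
      - r * (r ^ 2 + 2) * arccos (r / 2) * √(1 - r ^ 2 / 4) - r ^ 2 / 2 + r ^ 4 / 8 - r ^ 6 / 24)
      (Icc 0 2) :=
    Continuous.continuousOn (by fun_prop)
  have hint : IntervalIntegrable
      (fun r : ℝ => r * (2 * arccos (r / 2) - r * √(1 - r ^ 2 / 4)) ^ 2) volume 0 2 :=
    Continuous.intervalIntegrable (by fun_prop) _ _
  rw [integral_eq_sub_of_hasDerivAt_of_le (by norm_num) hcont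
    (fun r hr => hasDerivAt_sqLensAreaPrim (by linarith [hr.1]) hr.2) hint]
  have h1 : arccos ((2:ℝ) / 2) = 0 := by norm_num
  have h0 : arccos ((0:ℝ) / 2) = π / 2 := by norm_num
  rw [h1, h0]
  ring

/-- `∫₀¹ r A(r)² dr = π²/2 − √3π/2 − 5/12`. [folklore] -/
theorem integral_mul_sqLensArea_one :
    ∫ r in (0:ℝ)..1, r * (2 * arccos (r / 2) - r * √(1 - r ^ 2 / 4)) ^ 2 =
      π ^ 2 / 2 - √3 * π / 2 - 5 / 12 := by
  have hcont : ContinuousOn (fun r : ℝ => 2 * (r ^ 2 - 1) * arccos (r / 2) ^ 2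
      - r * (r ^ 2 + 2) * arccos (r / 2) * √(1 - r ^ 2 / 4) - r ^ 2 / 2 + r ^ 4 / 8 - r ^ 6 / 24)
      (Icc 0 1) :=
    Continuous.continuousOn (by fun_prop)
  have hint : IntervalIntegrable
      (fun r : ℝ => r * (2 * arccos (r / 2) - r * √(1 - r ^ 2 / 4)) ^ 2) volume 0 1 :=
    Continuous.intervalIntegrable (by fun_prop) _ _
  rw [integral_eq_sub_of_hasDerivAt_of_le zero_le_one hcont
    (fun r hr => hasDerivAt_sqLensAreaPrim (by linarith [hr.1]) (by linarith [hr.2])) hint]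
  have h4 : √(4:ℝ) = 2 := by
    rw [show (4:ℝ) = 2 ^ 2 by norm_num, Real.sqrt_sq (by norm_num)]
  have h34 : √(1 - 1 ^ 2 / 4 : ℝ) = √3 / 2 := by
    rw [show (1 - 1 ^ 2 / 4 : ℝ) = 3 / 4 by norm_num, Real.sqrt_div (by norm_num), h4]
  have h0 : arccos ((0:ℝ) / 2) = π / 2 := by norm_num
  have h1 : arccos ((1:ℝ) / 2) = π / 3 := by
    rw [show (1:ℝ) / 2 = cos (π / 3) by rw [cos_pi_div_three], arccos_cos (by positivity)
      (by linarith [pi_pos])]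
  rw [h34, h0, h1]
  ring

/-! ### Radial functions on `ℝ × ℝ`: Tonelli in polar coordinates -/

/-- For a continuous profile `f ≥ 0` on `(0, c)`:
`∫⁻_{|p| < c} f(|p|) dp = 2π · ∫₀ᶜ r f(r) dr` (polar coordinates). [folklore] -/
theorem lintegral_radial_ite {c : ℝ} (hc : 0 < c) {f : ℝ → ℝ} (hf : Continuous f)
    (hnn : ∀ r ∈ Ioo 0 c, 0 ≤ f r) :
    ∫⁻ p : ℝ × ℝ, (if p.1 ^ 2 + p.2 ^ 2 < c ^ 2 then
        ENNReal.ofReal (f (√(p.1 ^ 2 + p.2 ^ 2))) else 0) =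
      ENNReal.ofReal (2 * π) * ENNReal.ofReal (∫ r in (0:ℝ)..c, r * f r) := by
  have hmeas : Measurable fun r : ℝ => if r < c then ENNReal.ofReal (r * f r) else 0 :=
    Measurable.ite measurableSet_Iio
      (ENNReal.continuous_ofReal.comp (continuous_id.mul hf)).measurable measurable_const
  rw [← lintegral_comp_polarCoord_symm]
  have heq : EqOn (fun x : ℝ × ℝ => ENNReal.ofReal x.1 •
      (if (polarCoord.symm x).1 ^ 2 + (polarCoord.symm x).2 ^ 2 < c ^ 2 then
        ENNReal.ofReal (f (√((polarCoord.symm x).1 ^ 2 + (polarCoord.symm x).2 ^ 2))) else 0))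
      (fun x => if x.1 < c then ENNReal.ofReal (x.1 * f x.1) else 0) polarCoord.target := by
    intro x hx
    have hr : 0 < x.1 := hx.1
    simp only [polarCoord_symm_apply, smul_eq_mul]
    have hsq : (x.1 * cos x.2) ^ 2 + (x.1 * sin x.2) ^ 2 = x.1 ^ 2 := by
      linear_combination x.1 ^ 2 * (cos_sq_add_sin_sq x.2)
    rw [hsq, sqrt_sq hr.le]
    by_cases h1 : x.1 < c
    · have : x.1 ^ 2 < c ^ 2 := by nlinarith
      rw [if_pos this, if_pos h1, ← ENNReal.ofReal_mul hr.le]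
    · have : ¬ x.1 ^ 2 < c ^ 2 := by intro h; apply h1; nlinarith
      rw [if_neg this, if_neg h1, mul_zero]
  rw [setLIntegral_congr_fun polarCoord.open_target.measurableSet heq, polarCoord_target,
    Measure.volume_eq_prod, ← Measure.prod_restrict,
    lintegral_prod (fun x : ℝ × ℝ => if x.1 < c then ENNReal.ofReal (x.1 * f x.1) else 0)
      (hmeas.comp measurable_fst).aemeasurable]
  simp only [lintegral_const, Measure.restrict_apply_univ, Real.volume_Ioo]
  rw [lintegral_mul_const _ hmeas]
  have hΨ : (fun r : ℝ => if r < c then ENNReal.ofReal (r * f r) else 0) =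
      (Iio c).indicator (fun r => ENNReal.ofReal (r * f r)) := by
    funext r; simp only [Set.indicator_apply, mem_Iio]
  rw [hΨ, lintegral_indicator measurableSet_Iio, Measure.restrict_restrict measurableSet_Iio,
    Iio_inter_Ioi]
  have hint : IntegrableOn (fun r : ℝ => r * f r) (Ioo 0 c) volume :=
    (Continuous.integrableOn_Icc (by fun_prop)).mono_set Ioo_subset_Icc_self
  have hnn' : 0 ≤ᵐ[volume.restrict (Ioo (0:ℝ) c)] fun r : ℝ => r * f r := by
    filter_upwards [ae_restrict_mem measurableSet_Ioo] with r hr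
    exact mul_nonneg hr.1.le (hnn r hr)
  rw [← ofReal_integral_eq_lintegral_ofReal hint hnn', ← integral_Ioc_eq_integral_Ioo,
    ← intervalIntegral.integral_of_le hc.le, mul_comm]
  congr 1
  ring_nf

/-! ### The ring and diamond diagrams in product coordinates `(x₃, (x₂, x₄))` -/

/-- The ring configuration set in product coordinates `(p, (a, b)) = (x₃, (x₂, x₄))` is
measurable. [folklore] -/
theorem measurableSet_ringProd : MeasurableSet {x : (ℝ × ℝ) × ((ℝ × ℝ) × (ℝ × ℝ)) |
      x.2.1.1 ^ 2 + x.2.1.2 ^ 2 < 1 ∧ (x.2.1.1 - x.1.1) ^ 2 + (x.2.1.2 - x.1.2) ^ 2 < 1 ∧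
        (x.1.1 - x.2.2.1) ^ 2 + (x.1.2 - x.2.2.2) ^ 2 < 1 ∧ x.2.2.1 ^ 2 + x.2.2.2 ^ 2 < 1} := by
  simp only [setOf_and]
  refine MeasurableSet.inter ?_ (MeasurableSet.inter ?_ (MeasurableSet.inter ?_ ?_)) <;>
    exact measurableSet_lt (by fun_prop) (by fun_prop)

/-- The diamond configuration set in product coordinates is measurable. [folklore] -/
theorem measurableSet_diamondProd : MeasurableSet {x : (ℝ × ℝ) × ((ℝ × ℝ) × (ℝ × ℝ)) |
      x.2.1.1 ^ 2 + x.2.1.2 ^ 2 < 1 ∧ x.1.1 ^ 2 + x.1.2 ^ 2 < 1 ∧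
        (x.2.1.1 - x.1.1) ^ 2 + (x.2.1.2 - x.1.2) ^ 2 < 1 ∧
        (x.1.1 - x.2.2.1) ^ 2 + (x.1.2 - x.2.2.2) ^ 2 < 1 ∧ x.2.2.1 ^ 2 + x.2.2.2 ^ 2 < 1} := by
  simp only [setOf_and]
  refine MeasurableSet.inter ?_ (MeasurableSet.inter ?_
    (MeasurableSet.inter ?_ (MeasurableSet.inter ?_ ?_))) <;>
    exact measurableSet_lt (by fun_prop) (by fun_prop)

/-- The `x₃`-slice of the ring set is `lens(x₃) × lens(x₃)`. [folklore] -/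
theorem slice_ringProd (p : ℝ × ℝ) :
    Prod.mk p ⁻¹' {x : (ℝ × ℝ) × ((ℝ × ℝ) × (ℝ × ℝ)) |
      x.2.1.1 ^ 2 + x.2.1.2 ^ 2 < 1 ∧ (x.2.1.1 - x.1.1) ^ 2 + (x.2.1.2 - x.1.2) ^ 2 < 1 ∧
        (x.1.1 - x.2.2.1) ^ 2 + (x.1.2 - x.2.2.2) ^ 2 < 1 ∧ x.2.2.1 ^ 2 + x.2.2.2 ^ 2 < 1} =
      {q : ℝ × ℝ | q.1 ^ 2 + q.2 ^ 2 < 1 ∧ (p.1 - q.1) ^ 2 + (p.2 - q.2) ^ 2 < 1} ×ˢ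
      {q : ℝ × ℝ | q.1 ^ 2 + q.2 ^ 2 < 1 ∧ (p.1 - q.1) ^ 2 + (p.2 - q.2) ^ 2 < 1} := by
  ext y
  simp only [mem_preimage, mem_setOf_eq, mem_prod]
  have h1 : (y.1.1 - p.1) ^ 2 + (y.1.2 - p.2) ^ 2 = (p.1 - y.1.1) ^ 2 + (p.2 - y.1.2) ^ 2 := by ring
  rw [h1]
  tauto

/-- The `x₃`-slice of the diamond set is `lens(x₃) × lens(x₃)` if `|x₃| < 1`, else empty.
[folklore] -/
theorem slice_diamondProd (p : ℝ × ℝ) :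
    Prod.mk p ⁻¹' {x : (ℝ × ℝ) × ((ℝ × ℝ) × (ℝ × ℝ)) |
      x.2.1.1 ^ 2 + x.2.1.2 ^ 2 < 1 ∧ x.1.1 ^ 2 + x.1.2 ^ 2 < 1 ∧
        (x.2.1.1 - x.1.1) ^ 2 + (x.2.1.2 - x.1.2) ^ 2 < 1 ∧
        (x.1.1 - x.2.2.1) ^ 2 + (x.1.2 - x.2.2.2) ^ 2 < 1 ∧ x.2.2.1 ^ 2 + x.2.2.2 ^ 2 < 1} =
      if p.1 ^ 2 + p.2 ^ 2 < 1 then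
        {q : ℝ × ℝ | q.1 ^ 2 + q.2 ^ 2 < 1 ∧ (p.1 - q.1) ^ 2 + (p.2 - q.2) ^ 2 < 1} ×ˢ
        {q : ℝ × ℝ | q.1 ^ 2 + q.2 ^ 2 < 1 ∧ (p.1 - q.1) ^ 2 + (p.2 - q.2) ^ 2 < 1}
      else ∅ := by
  ext y
  simp only [mem_preimage, mem_setOf_eq]
  have h1 : (y.1.1 - p.1) ^ 2 + (y.1.2 - p.2) ^ 2 = (p.1 - y.1.1) ^ 2 + (p.2 - y.1.2) ^ 2 := by ring
  rw [h1]
  split_ifs with hp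
  · simp only [mem_prod, mem_setOf_eq]
    tauto
  · simp only [mem_empty_iff_false, iff_false]
    tauto

/-- Volume of the `x₃`-slices of the ring set: `A(|x₃|)²` (`0` if `|x₃| ≥ 2`). [folklore] -/
theorem volume_slice_ringProd (p : ℝ × ℝ) :
    volume (Prod.mk p ⁻¹' {x : (ℝ × ℝ) × ((ℝ × ℝ) × (ℝ × ℝ)) |
      x.2.1.1 ^ 2 + x.2.1.2 ^ 2 < 1 ∧ (x.2.1.1 - x.1.1) ^ 2 + (x.2.1.2 - x.1.2) ^ 2 < 1 ∧
        (x.1.1 - x.2.2.1) ^ 2 + (x.1.2 - x.2.2.2) ^ 2 < 1 ∧ x.2.2.1 ^ 2 + x.2.2.2 ^ 2 < 1}) =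
      if p.1 ^ 2 + p.2 ^ 2 < 2 ^ 2 then ENNReal.ofReal ((2 * arccos (√(p.1 ^ 2 + p.2 ^ 2) / 2) -
        √(p.1 ^ 2 + p.2 ^ 2) * √(1 - √(p.1 ^ 2 + p.2 ^ 2) ^ 2 / 4)) ^ 2) else 0 := by
  rw [slice_ringProd, Measure.volume_eq_prod, Measure.prod_prod, volume_lensAt_eq_ite]
  have hρ0 : 0 ≤ √(p.1 ^ 2 + p.2 ^ 2) := sqrt_nonneg _
  by_cases hp : p.1 ^ 2 + p.2 ^ 2 < 4
  · have hp' : p.1 ^ 2 + p.2 ^ 2 < 2 ^ 2 := by norm_num; exact hp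
    have hρ2 : √(p.1 ^ 2 + p.2 ^ 2) < 2 := by
      rw [show (2:ℝ) = √4 by rw [show (4:ℝ) = 2 ^ 2 by norm_num, sqrt_sq (by norm_num)]]
      exact sqrt_lt_sqrt (by positivity) hp
    rw [if_pos hp, if_pos hp', ← ENNReal.ofReal_mul (volume_lens_lt_two hρ0 hρ2).2]
    congr 1; ring
  · have hp' : ¬ p.1 ^ 2 + p.2 ^ 2 < 2 ^ 2 := by norm_num; exact not_lt.mp hp
    rw [if_neg hp, if_neg hp', mul_zero]

/-- Volume of the `x₃`-slices of the diamond set: `A(|x₃|)²` if `|x₃| < 1`, else `0`. [folklore] -/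
theorem volume_slice_diamondProd (p : ℝ × ℝ) :
    volume (Prod.mk p ⁻¹' {x : (ℝ × ℝ) × ((ℝ × ℝ) × (ℝ × ℝ)) |
      x.2.1.1 ^ 2 + x.2.1.2 ^ 2 < 1 ∧ x.1.1 ^ 2 + x.1.2 ^ 2 < 1 ∧
        (x.2.1.1 - x.1.1) ^ 2 + (x.2.1.2 - x.1.2) ^ 2 < 1 ∧
        (x.1.1 - x.2.2.1) ^ 2 + (x.1.2 - x.2.2.2) ^ 2 < 1 ∧ x.2.2.1 ^ 2 + x.2.2.2 ^ 2 < 1}) =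
      if p.1 ^ 2 + p.2 ^ 2 < 1 ^ 2 then ENNReal.ofReal ((2 * arccos (√(p.1 ^ 2 + p.2 ^ 2) / 2) -
        √(p.1 ^ 2 + p.2 ^ 2) * √(1 - √(p.1 ^ 2 + p.2 ^ 2) ^ 2 / 4)) ^ 2) else 0 := by
  rw [slice_diamondProd]
  have hρ0 : 0 ≤ √(p.1 ^ 2 + p.2 ^ 2) := sqrt_nonneg _
  by_cases hp : p.1 ^ 2 + p.2 ^ 2 < 1
  · have hp' : p.1 ^ 2 + p.2 ^ 2 < 1 ^ 2 := by norm_num; exact hp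
    have hp4 : p.1 ^ 2 + p.2 ^ 2 < 4 := by linarith
    have hρ2 : √(p.1 ^ 2 + p.2 ^ 2) < 2 := by
      rw [show (2:ℝ) = √4 by rw [show (4:ℝ) = 2 ^ 2 by norm_num, sqrt_sq (by norm_num)]]
      exact sqrt_lt_sqrt (by positivity) hp4
    rw [if_pos hp, if_pos hp', Measure.volume_eq_prod, Measure.prod_prod,
      volume_lensAt_eq_ite, if_pos hp4, ← ENNReal.ofReal_mul (volume_lens_lt_two hρ0 hρ2).2]
    congr 1; ring
  · have hp' : ¬ p.1 ^ 2 + p.2 ^ 2 < 1 ^ 2 := by norm_num; exact not_lt.mp hp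
    rw [if_neg hp, if_neg hp', measure_empty]

/-- Volume of the ring set in product coordinates: `2π · (π²/2 − 8/3)`. [folklore] -/
theorem volume_ringProd :
    volume {x : (ℝ × ℝ) × ((ℝ × ℝ) × (ℝ × ℝ)) |
      x.2.1.1 ^ 2 + x.2.1.2 ^ 2 < 1 ∧ (x.2.1.1 - x.1.1) ^ 2 + (x.2.1.2 - x.1.2) ^ 2 < 1 ∧
        (x.1.1 - x.2.2.1) ^ 2 + (x.1.2 - x.2.2.2) ^ 2 < 1 ∧ x.2.2.1 ^ 2 + x.2.2.2 ^ 2 < 1} =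
      ENNReal.ofReal (2 * π) * ENNReal.ofReal (π ^ 2 / 2 - 8 / 3) := by
  rw [Measure.volume_eq_prod, Measure.prod_apply measurableSet_ringProd]
  simp only [volume_slice_ringProd]
  rw [lintegral_radial_ite (c := 2) (by norm_num)
      (f := fun r => (2 * arccos (r / 2) - r * √(1 - r ^ 2 / 4)) ^ 2) (by fun_prop)
      (fun r _ => sq_nonneg _), integral_mul_sqLensArea_two]

/-- Volume of the diamond set in product coordinates: `2π · (π²/2 − √3π/2 − 5/12)`. [folklore] -/
theorem volume_diamondProd :
    volume {x : (ℝ × ℝ) × ((ℝ × ℝ) × (ℝ × ℝ)) |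
      x.2.1.1 ^ 2 + x.2.1.2 ^ 2 < 1 ∧ x.1.1 ^ 2 + x.1.2 ^ 2 < 1 ∧
        (x.2.1.1 - x.1.1) ^ 2 + (x.2.1.2 - x.1.2) ^ 2 < 1 ∧
        (x.1.1 - x.2.2.1) ^ 2 + (x.1.2 - x.2.2.2) ^ 2 < 1 ∧ x.2.2.1 ^ 2 + x.2.2.2 ^ 2 < 1} =
      ENNReal.ofReal (2 * π) * ENNReal.ofReal (π ^ 2 / 2 - √3 * π / 2 - 5 / 12) := by
  rw [Measure.volume_eq_prod, Measure.prod_apply measurableSet_diamondProd]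
  simp only [volume_slice_diamondProd]
  rw [lintegral_radial_ite (c := 1) (by norm_num)
      (f := fun r => (2 * arccos (r / 2) - r * √(1 - r ^ 2 / 4)) ^ 2) (by fun_prop)
      (fun r _ => sq_nonneg _), integral_mul_sqLensArea_one]

/-! ### From `Fin 6 → ℝ` to `(ℝ × ℝ) × ((ℝ × ℝ) × (ℝ × ℝ))` -/

/-- The coordinate map `(p, (a, b)) ↦ ![a₁, a₂, p₁, p₂, b₁, b₂]` (`x₃ = p` first) is measurable.
[folklore] -/
theorem measurable_toFin6 : Measurable fun x : (ℝ × ℝ) × ((ℝ × ℝ) × (ℝ × ℝ)) =>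
    (![x.2.1.1, x.2.1.2, x.1.1, x.1.2, x.2.2.1, x.2.2.2] : Fin 6 → ℝ) := by
  refine measurable_pi_lambda _ (fun i => ?_)
  fin_cases i
  · exact measurable_snd.fst.fst
  · exact measurable_snd.fst.snd
  · exact measurable_fst.fst
  · exact measurable_fst.snd
  · exact measurable_snd.snd.fst
  · exact measurable_snd.snd.snd

/-- The coordinate map carries the product Lebesgue measure to that of `Fin 6 → ℝ`
(`Measure.pi_eq`: both give a box the product of its side lengths). [folklore] -/
theorem measurePreserving_toFin6 : MeasurePreserving (fun x : (ℝ × ℝ) × ((ℝ × ℝ) × (ℝ × ℝ)) =>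
    (![x.2.1.1, x.2.1.2, x.1.1, x.1.2, x.2.2.1, x.2.2.2] : Fin 6 → ℝ)) volume volume := by
  refine ⟨measurable_toFin6, ?_⟩
  symm
  rw [volume_pi]
  refine Measure.pi_eq (fun s hs => ?_)
  rw [Measure.map_apply measurable_toFin6 (MeasurableSet.univ_pi hs)]
  have : (fun x : (ℝ × ℝ) × ((ℝ × ℝ) × (ℝ × ℝ)) =>
      (![x.2.1.1, x.2.1.2, x.1.1, x.1.2, x.2.2.1, x.2.2.2] : Fin 6 → ℝ)) ⁻¹' (Set.pi univ s) =
      (s 2 ×ˢ s 3) ×ˢ ((s 0 ×ˢ s 1) ×ˢ (s 4 ×ˢ s 5)) := by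
    ext x
    simp only [mem_preimage, mem_univ_pi, mem_prod]
    constructor
    · intro h; exact ⟨⟨h 2, h 3⟩, ⟨h 0, h 1⟩, h 4, h 5⟩
    · rintro ⟨⟨h2, h3⟩, ⟨h0, h1⟩, h4, h5⟩ i
      fin_cases i <;> assumption
  rw [this]
  simp only [Measure.volume_eq_prod, Measure.prod_prod, Fin.prod_univ_six]
  ring

/-- `ringDisc` is measurable. [folklore] -/
theorem measurableSet_ringDisc : MeasurableSet HardSphereVirial.ringDisc := by
  simp only [HardSphereVirial.ringDisc, setOf_and]
  refine MeasurableSet.inter ?_ (MeasurableSet.inter ?_ (MeasurableSet.inter ?_ ?_)) <;>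
    exact measurableSet_lt (by fun_prop) (by fun_prop)

/-- `diamondDisc` is measurable. [folklore] -/
theorem measurableSet_diamondDisc : MeasurableSet HardSphereVirial.diamondDisc := by
  simp only [HardSphereVirial.diamondDisc, setOf_and]
  refine MeasurableSet.inter ?_ (MeasurableSet.inter ?_
    (MeasurableSet.inter ?_ (MeasurableSet.inter ?_ ?_))) <;>
    exact measurableSet_lt (by fun_prop) (by fun_prop)

end HardDiscRingVolume

open HardDiscRingVolume in
/-- **Volume of the ring Mayer diagram `C₄` of hard discs**: `vol(ringDisc) = π³ − 16π/3`
(the lens-convolution value `2π∫₀² rA(r)² dr`; cf. the ring entries of the tables of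
Clisby–McCoy 2004 and Lyberg 2005). [folklore] -/
theorem volume_ringDisc_toReal :
    (volume HardSphereVirial.ringDisc).toReal = π ^ 3 - 16 * π / 3 := by
  have hpre : (fun x : (ℝ × ℝ) × ((ℝ × ℝ) × (ℝ × ℝ)) =>
      (![x.2.1.1, x.2.1.2, x.1.1, x.1.2, x.2.2.1, x.2.2.2] : Fin 6 → ℝ)) ⁻¹'
      HardSphereVirial.ringDisc = {x : (ℝ × ℝ) × ((ℝ × ℝ) × (ℝ × ℝ)) |
      x.2.1.1 ^ 2 + x.2.1.2 ^ 2 < 1 ∧ (x.2.1.1 - x.1.1) ^ 2 + (x.2.1.2 - x.1.2) ^ 2 < 1 ∧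
        (x.1.1 - x.2.2.1) ^ 2 + (x.1.2 - x.2.2.2) ^ 2 < 1 ∧ x.2.2.1 ^ 2 + x.2.2.2 ^ 2 < 1} := by
    ext x
    simp [HardSphereVirial.ringDisc]
  have h8 : (8:ℝ) / 3 ≤ π ^ 2 / 2 := by nlinarith [Real.pi_gt_three]
  rw [← measurePreserving_toFin6.measure_preimage measurableSet_ringDisc.nullMeasurableSet, hpre,
    volume_ringProd, ENNReal.toReal_mul, ENNReal.toReal_ofReal (by positivity),
    ENNReal.toReal_ofReal (by linarith)]
  ring

open HardDiscRingVolume in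
/-- **Volume of the diagonal-square Mayer diagram `◇` of hard discs**:
`vol(diamondDisc) = π³ − √3π² − 5π/6` (the lens-convolution value `2π∫₀¹ rA(r)² dr`; cf. the
tables of Clisby–McCoy 2004 and Lyberg 2005). [folklore] -/
theorem volume_diamondDisc_toReal :
    (volume HardSphereVirial.diamondDisc).toReal = π ^ 3 - √3 * π ^ 2 - 5 * π / 6 := by
  have hpre : (fun x : (ℝ × ℝ) × ((ℝ × ℝ) × (ℝ × ℝ)) =>
      (![x.2.1.1, x.2.1.2, x.1.1, x.1.2, x.2.2.1, x.2.2.2] : Fin 6 → ℝ)) ⁻¹'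
      HardSphereVirial.diamondDisc = {x : (ℝ × ℝ) × ((ℝ × ℝ) × (ℝ × ℝ)) |
      x.2.1.1 ^ 2 + x.2.1.2 ^ 2 < 1 ∧ x.1.1 ^ 2 + x.1.2 ^ 2 < 1 ∧
        (x.2.1.1 - x.1.1) ^ 2 + (x.2.1.2 - x.1.2) ^ 2 < 1 ∧
        (x.1.1 - x.2.2.1) ^ 2 + (x.1.2 - x.2.2.2) ^ 2 < 1 ∧ x.2.2.1 ^ 2 + x.2.2.2 ^ 2 < 1} := by
    ext x
    simp [HardSphereVirial.diamondDisc]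
  have h3 : √3 < 2 := by
    rw [show (2:ℝ) = √4 by rw [show (4:ℝ) = 2 ^ 2 by norm_num, sqrt_sq (by norm_num)]]
    exact sqrt_lt_sqrt (by norm_num) (by norm_num)
  have h8 : √3 * π / 2 + 5 / 12 ≤ π ^ 2 / 2 := by nlinarith [Real.pi_gt_three]
  rw [← measurePreserving_toFin6.measure_preimage measurableSet_diamondDisc.nullMeasurableSet,
    hpre, volume_diamondProd, ENNReal.toReal_mul, ENNReal.toReal_ofReal (by positivity),
    ENNReal.toReal_ofReal (by linarith)]
  ring

end Literature.MathematicalPhysics.StatisticalMechanics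

end
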